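import Summits.ResolutionOfSingularities.ResolutionOfSingularities.Theses.QuotientModels
import Summits.ResolutionOfSingularities.ResolutionOfSingularities.Theorems.FrobeniusSandwichClasses
import Summits.ResolutionOfSingularities.ResolutionOfSingularities.Theorems.QuotientModelsMinimalHeight
import HarnessLib

/-!
# QuotientModelsFrobeniusSandwich — kernels of the decomp-res node «FrobeniusSandwich» (lens-5 g8) BY NAME

Source HOME/decomp-res-lens-5/g8/FrobeniusSandwich.lean (sha256 485175a5c4c88ec4; critic `lean check` rc 0, 0 sorry,
`pieces_of_summit` axioms standard), CRITIC-LEDGER row 50 (2026-08-30T07:17Z): CLEARED AS MAP NODE (residual 0 ·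
decision 0 · map +1).  An ASIDE LADDER under the crux `QuotientModels.HeightOneDescent` (H, 27195) on its LOCATED
class: the Frobenius sandwiches of rational four-space `k(x₁,…,x₄) ⊇ K ⊇ k(xᵢ^{p^m})`, ladder parameter the sandwich
exponent `m`.  Pieces = asides of `Theses/QuotientModels.lean` rev 7 over `Theorems.FrobeniusSandwichClasses`
(p765891): `RatSandwichRegModelsFourOne` [rung (4,1) = first open cell; NECESSARY mod port; WEAKER by letter;
substance UNDECIDED; IDEA-NEEDED (additive foliation points); INSTRUMENTABLE T-FS-1], `RatSandwichRegModelsFourTwo`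
[located envelope of every held wild specimen; self-similar], `RatIndexPDescentFour` [the census rung RatH1D₄ typed
= H° ∩ (top = k(x))], `SandwichHeightOneDescentFour` [bridge = H|sandwich, implication piece, credit 0],
`PIUnirationalRegModelsFour` [asymptote, EXACT limit].  The port `SandwichFieldsPort 4` (COSTUME(cite):
sub-extensions of finitely generated extensions are finitely generated; projective closure; `k(x)` finite over
`k(x^{p^m})`) and the base rung `RatSandwichRegModels 4 0` (`K = k(x)`, ℙ⁴: KNOWN costume) are HYPOTHESES of the
kernels, never items.  Kernels (all PROVED, 0 sorry): the ladder BY NAME (`fourOne_of_fourTwo`, `indexP_of_fourOne`,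
`fourTwo_of_fourOne_of_bridge`, `all_of_zero_of_bridge`, `piuFour_iff_forall`, `piuFour_of_zero_of_bridge`), the
bridge from H (`sandwichDescentFour_of_heightOneDescent`, mod port), NECESSITY from RM 27197 mod port
(`fourOne_of_regularModels`, `fourTwo_of_regularModels`, `indexP_of_regularModels`,
`sandwichDescentFour_of_regularModels`, `piuFour_of_regularModels`) and from the ROOT (`regularModels_of_summit`,
`asides_of_summit`).  The ROOT itself is reached through `QuotientModels.closes` BY NAME (MR 24572 → C′ 27196 → E
27194 → H 27195); the ladder adds nothing to the cone (NAMED-RUNG RULE).  Why this is novel (cell-relative): the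
first typed statement on the models half whose parameter is the DESCENT DEPTH inside a FIXED rational envelope, with
a self-contained successor kernel (the Frobenius closure of a sandwich is a sandwich); transverse to the local-type
cuts (28815, radicand cuts) and to MinimalHeight's index cut, whose located intersection `RatIndexPDescentFour` it
types.  (Hartshorne 1977 II.4.9; Rudakov–Šafarevič 1976; Kollár 2007 §1.)
-/

namespace Summit.ResolutionOfSingularities.ResolutionOfSingularities.Theorems.QuotientModelsFrobeniusSandwich

open CategoryTheory AlgebraicGeometry
open Literature.AlgebraicGeometry.Resolution
open Summit.ResolutionOfSingularities.ResolutionOfSingularities.Theses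
open Summit.ResolutionOfSingularities.ResolutionOfSingularities.Theorems
open FrobeniusSandwichClasses

/-! ## The ladder BY NAME -/

/-- Rung (4,2) gives rung (4,1). [folklore] -/
theorem fourOne_of_fourTwo (h : QuotientModels.RatSandwichRegModelsFourTwo) :
    QuotientModels.RatSandwichRegModelsFourOne :=
  ratSandwich_mono (by norm_num) h

/-- Rung (4,1) contains the census rung RatH1D₄. [folklore] -/
theorem indexP_of_fourOne (h : QuotientModels.RatSandwichRegModelsFourOne) : QuotientModels.RatIndexPDescentFour :=
  ratIndexP_of_ratSandwich_one h

/-- Rung (4,1) and the bridge give rung (4,2) (THE bridge kernel, through the p-radical closure). [folklore] -/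
theorem fourTwo_of_fourOne_of_bridge (h : QuotientModels.RatSandwichRegModelsFourOne)
    (hB : QuotientModels.SandwichHeightOneDescentFour) : QuotientModels.RatSandwichRegModelsFourTwo :=
  ratSandwich_succ_of_bridge h hB

/-- The KNOWN base rung `m = 0` (hypothesis: `K = k(x)`, ℙ⁴) and the bridge give every rung. [folklore] -/
theorem all_of_zero_of_bridge (h0 : RatSandwichRegModels 4 0) (hB : QuotientModels.SandwichHeightOneDescentFour) :
    ∀ m : ℕ, RatSandwichRegModels 4 m :=
  ratSandwich_all_of_zero h0 hB

/-- EXACT limit: the asymptote ⟺ all rungs. [folklore] -/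
theorem piuFour_iff_forall : QuotientModels.PIUnirationalRegModelsFour ↔ ∀ m : ℕ, RatSandwichRegModels 4 m :=
  piu_iff_forall_ratSandwich

/-- The base rung and the bridge give the asymptote. [folklore] -/
theorem piuFour_of_zero_of_bridge (h0 : RatSandwichRegModels 4 0) (hB : QuotientModels.SandwichHeightOneDescentFour) :
    QuotientModels.PIUnirationalRegModelsFour :=
  piu_of_zero_of_bridge h0 hB

/-- The asymptote gives both filed rungs and the census rung. [folklore] -/
theorem rungs_of_piuFour (h : QuotientModels.PIUnirationalRegModelsFour) :
    QuotientModels.RatSandwichRegModelsFourTwo ∧ QuotientModels.RatSandwichRegModelsFourOne ∧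
      QuotientModels.RatIndexPDescentFour :=
  ⟨piuFour_iff_forall.mp h 2, piuFour_iff_forall.mp h 1, indexP_of_fourOne (piuFour_iff_forall.mp h 1)⟩

/-! ## The bridge is H restricted (mod port) -/

/-- `SandwichFieldsPort 4 → H (27195) → SandwichHeightOneDescentFour`: H's binders instantiated with the inclusion
algebra `K → K₁`, the Frobenius-range hypothesis from `K₁ᵖ ⊆ K`, finiteness from the port. [folklore] -/
theorem sandwichDescentFour_of_heightOneDescent (hP : SandwichFieldsPort 4) (hH : QuotientModels.HeightOneDescent) :
    QuotientModels.SandwichHeightOneDescentFour := by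
  intro p hp k _ _ m K K₁ hle hK₁ hfrob hN₁
  have hK : ∀ i : Fin 4, xv k 4 i ^ p ^ (m + 1) ∈ K := fun i => by
    rw [pow_succ, pow_mul]; exact hfrob _ (hK₁ i)
  obtain ⟨hfg, -, hfin⟩ := hP p hp k (m + 1) K hK
  haveI : Algebra.EssFiniteType k K := hfg
  letI : Algebra K K₁ := (IntermediateField.inclusion hle).toRingHom.toAlgebra
  haveI : Module.Finite K K₁ := hfin K₁ hle
  haveI : IsScalarTower k K K₁ := IsScalarTower.of_algebraMap_eq fun x => rfl
  refine hH p hp k K K₁ (fun x => ?_) hN₁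
  refine ⟨⟨(x : RatFun k 4) ^ p, hfrob _ x.2⟩, ?_⟩
  apply Subtype.ext
  show ((x : RatFun k 4) ^ p) = ((x ^ p : K₁) : RatFun k 4)
  simp

/-- With the KNOWN base rung, H (mod port) gives the whole ladder: every rung and the asymptote. [folklore] -/
theorem piuFour_of_heightOneDescent (hP : SandwichFieldsPort 4) (h0 : RatSandwichRegModels 4 0)
    (hH : QuotientModels.HeightOneDescent) : QuotientModels.PIUnirationalRegModelsFour :=
  piuFour_of_zero_of_bridge h0 (sandwichDescentFour_of_heightOneDescent hP hH)

/-! ## NECESSITY from `RegularModels` (27197 = Zariski's RM) and from the ROOT, mod port -/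

/-- Every rung from RM, mod port. [folklore] -/
theorem ratSandwichFour_of_regularModels (hP : SandwichFieldsPort 4) (hRM : QuotientModels.RegularModels) (m : ℕ) :
    RatSandwichRegModels 4 m := by
  intro p hp k _ _ K hK
  obtain ⟨hfg, hM, -⟩ := hP p hp k m K hK
  haveI : Algebra.EssFiniteType k K := hfg
  exact hRM p hp k K hM

/-- Rung (4,1) from RM, mod port. [folklore] -/
theorem fourOne_of_regularModels (hP : SandwichFieldsPort 4) (hRM : QuotientModels.RegularModels) :
    QuotientModels.RatSandwichRegModelsFourOne :=
  ratSandwichFour_of_regularModels hP hRM 1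

/-- Rung (4,2) from RM, mod port. [folklore] -/
theorem fourTwo_of_regularModels (hP : SandwichFieldsPort 4) (hRM : QuotientModels.RegularModels) :
    QuotientModels.RatSandwichRegModelsFourTwo :=
  ratSandwichFour_of_regularModels hP hRM 2

/-- The census rung from RM, mod port. [folklore] -/
theorem indexP_of_regularModels (hP : SandwichFieldsPort 4) (hRM : QuotientModels.RegularModels) :
    QuotientModels.RatIndexPDescentFour :=
  indexP_of_fourOne (fourOne_of_regularModels hP hRM)

/-- The asymptote from RM, mod port. [folklore] -/
theorem piuFour_of_regularModels (hP : SandwichFieldsPort 4) (hRM : QuotientModels.RegularModels) :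
    QuotientModels.PIUnirationalRegModelsFour :=
  piuFour_iff_forall.mpr (ratSandwichFour_of_regularModels hP hRM)

/-- The bridge from RM, mod port (ignore the top). [folklore] -/
theorem sandwichDescentFour_of_regularModels (hP : SandwichFieldsPort 4) (hRM : QuotientModels.RegularModels) :
    QuotientModels.SandwichHeightOneDescentFour := by
  intro p hp k _ _ m K K₁ _ hK₁ hfrob _
  have hK : ∀ i : Fin 4, xv k 4 i ^ p ^ (m + 1) ∈ K := fun i => by
    rw [pow_succ, pow_mul]; exact hfrob _ (hK₁ i)
  exact ratSandwichFour_of_regularModels hP hRM (m + 1) p hp k K hK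

/-- `RegularModels` (27197) from the ROOT (tree: `QuotientModelsMinimalHeight.pieces_of_summit`). [folklore] -/
theorem regularModels_of_summit (h : _root_.ResolutionOfSingularities) : QuotientModels.RegularModels :=
  (QuotientModelsMinimalHeight.pieces_of_summit h).1

/-- NECESSITY: every aside of the node from the ROOT, mod the port. [folklore] -/
theorem asides_of_summit (hP : SandwichFieldsPort 4) (h : _root_.ResolutionOfSingularities) :
    QuotientModels.RatSandwichRegModelsFourOne ∧ QuotientModels.RatSandwichRegModelsFourTwo ∧
      QuotientModels.RatIndexPDescentFour ∧ QuotientModels.SandwichHeightOneDescentFour ∧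
      QuotientModels.PIUnirationalRegModelsFour :=
  have hRM := regularModels_of_summit h
  ⟨fourOne_of_regularModels hP hRM, fourTwo_of_regularModels hP hRM, indexP_of_regularModels hP hRM,
    sandwichDescentFour_of_regularModels hP hRM, piuFour_of_regularModels hP hRM⟩

/-- NECESSITY from the host crux alone is NOT claimed (HFS ⇏ H, K1 no collapse); what H gives, mod port and the known
base rung, is the whole ladder (`piuFour_of_heightOneDescent`), hence each filed aside. [folklore] -/
theorem asides_of_heightOneDescent (hP : SandwichFieldsPort 4) (h0 : RatSandwichRegModels 4 0)
    (hH : QuotientModels.HeightOneDescent) :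
    QuotientModels.RatSandwichRegModelsFourOne ∧ QuotientModels.RatSandwichRegModelsFourTwo ∧
      QuotientModels.RatIndexPDescentFour ∧ QuotientModels.SandwichHeightOneDescentFour ∧
      QuotientModels.PIUnirationalRegModelsFour :=
  have hA := piuFour_of_heightOneDescent hP h0 hH
  ⟨(rungs_of_piuFour hA).2.1, (rungs_of_piuFour hA).1, (rungs_of_piuFour hA).2.2,
    sandwichDescentFour_of_heightOneDescent hP hH, hA⟩

end Summit.ResolutionOfSingularities.ResolutionOfSingularities.Theorems.QuotientModelsFrobeniusSandwich
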